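import Literature.NumberTheory.LFunctions.HilbertInequality
import Mathlib.Analysis.Complex.ExponentialBounds

/-!
# The weighted Hilbert inequality for the frequencies `log n` (Ivić (5.5))

Topic `Literature/NumberTheory/LFunctions`.  PROVED:

* `norm_hilbertForm_log_le` — for every `N` and complex `a_1, …, a_N`,
  `|∑_{m ≠ n ≤ N} a_m ā_n / (log m - log n)| ≤ 464 ∑_{n ≤ N} n |a_n|²`
  (Ivić 1985, (5.5): `≪ ∑ n|a_n|²`; the special case `λ_n = log n` of the weighted Hilbert
  inequality of Montgomery–Vaughan, whose sharp constant is `3π/2`).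

This is the key input of the mean value theorem for Dirichlet polynomials (Ivić Thm 5.2,
`Ivic1985_theorem52`, proved in `DirichletPolynomialMeanValueThm52.lean`).  The file is
definition-free: the Hilbert form is written out as
`∑ m ∈ S, ∑ n ∈ S.erase m, a m * conj (a n) / ((log m - log n : ℝ) : ℂ)`, two indices `m, n` are
called *block-near* when `k(m) ≤ k(n) + 1 ∧ k(n) ≤ k(m) + 1` (`k = Nat.log 2`, i.e. their dyadic
blocks `[2^k, 2^{k+1})` coincide or are adjacent), and the *window* `V_k` is
`{n ∈ [1, N] : k(n) ≤ k + 1 ∧ k ≤ k(n) + 1}`.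

## Proof

Ivić's (= Ramachandra's) route, pp. 132–134, with the rounding-to-integers step replaced by the
real-frequency Hilbert inequality `hilbertInequality_of_separated`: by
`HilbertIneq.im_hilbertForm_le` with `Y = 1`,
`Im H ≤ ½ ∑|a_n|² - Re R(a)`, `R(a) = ∑_{m≠n} a_m ā_n (e^{i(L_m - L_n)} - 1)/(L_m - L_n)²`
(`L_n = log n`), and `R` is bounded in absolute value by `463 ∑ n|a_n|²`
(`HilbertIneqLog.norm_logRemainder_le`): for far pairs `|L_m - L_n| ≥ ½|k(m) - k(n)| log 2` and
the kernel `2/(L_m - L_n)²` is summed with the weights `2^{k(m) - k(n)}` (Ivić's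
`(k-l)^{-2}(S_k S_l)^{1/2}` step); for near pairs `(e^{ic} - 1)/c² = i/c + O(1)` and the singular
part is a sum over `k` of Hilbert forms on the windows `V_k`, where
`|L_m - L_n| ≥ |m - n|/2^{k+2}`, so that `norm_hilbertForm_le_of_separated` applies with
`δ = 2^{-(k+2)}`.  The same bound for `ā` (`H(ā) = -H(a)`) and `Re H = 0` give the two-sided
estimate.  Constants are not optimised.

## Sources

* A. Ivić, *The Riemann zeta-function* (1985), §5.2, (5.5), (5.11)–(5.13), pp. 132–134.
* K. Ramachandra (1980b in Ivić's bibliography); H. L. Montgomery, R. C. Vaughan, *Hilbert's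
  inequality*, J. London Math. Soc. (2) 8 (1974) 73–82 (sharp weighted form).
-/

open Finset Real MeasureTheory Complex
open scoped ComplexConjugate

namespace Literature.NumberTheory.LFunctions

namespace HilbertIneqLog

/-! ### Dyadic blocks -/

/-- `2^{k(n)} ≤ n` in `ℝ` for `n ≥ 1`. [folklore] -/
lemma two_pow_log_le {n : ℕ} (hn : 1 ≤ n) : (2 : ℝ) ^ Nat.log 2 n ≤ n := by
  exact_mod_cast Nat.pow_log_le_self 2 (by omega)

/-- `n < 2^{k(n)+1}` in `ℝ`. [folklore] -/
lemma lt_two_pow_log_succ (n : ℕ) : (n : ℝ) < 2 ^ (Nat.log 2 n + 1) := by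
  exact_mod_cast Nat.lt_pow_succ_log_self (by norm_num) n

/-- `(x - y)/x ≤ log x - log y` for `x, y > 0`. [folklore] -/
lemma sub_div_le_log_sub_log {x y : ℝ} (hx : 0 < x) (hy : 0 < y) :
    (x - y) / x ≤ Real.log x - Real.log y := by
  have := Real.one_sub_inv_le_log_of_pos (div_pos hx hy)
  rw [Real.log_div hx.ne' hy.ne', inv_div] at this
  calc (x - y) / x = 1 - y / x := by field_simp
    _ ≤ _ := this

/-- `|m - n|/M ≤ |log m - log n|` for naturals `1 ≤ m, n ≤ M`. [folklore] -/
lemma abs_sub_div_le_abs_log_sub_log {m n : ℕ} (hm : 1 ≤ m) (hn : 1 ≤ n) {M : ℝ}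
    (hmM : (m : ℝ) ≤ M) (hnM : (n : ℝ) ≤ M) :
    |(m : ℝ) - n| / M ≤ |Real.log m - Real.log n| := by
  have hm0 : (0 : ℝ) < m := by exact_mod_cast hm
  have hn0 : (0 : ℝ) < n := by exact_mod_cast hn
  rcases le_total (n : ℝ) m with h | h
  · rw [abs_of_nonneg (by linarith), abs_of_nonneg (by linarith [Real.log_le_log hn0 h])]
    calc ((m : ℝ) - n) / M ≤ ((m : ℝ) - n) / m := by
          apply div_le_div_of_nonneg_left (by linarith) hm0 hmM
      _ ≤ _ := sub_div_le_log_sub_log hm0 hn0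
  · rw [abs_of_nonpos (by linarith), abs_of_nonpos (by linarith [Real.log_le_log hm0 h])]
    calc -((m : ℝ) - n) / M = ((n : ℝ) - m) / M := by ring
      _ ≤ ((n : ℝ) - m) / n := by
          apply div_le_div_of_nonneg_left (by linarith) hn0 hnM
      _ ≤ Real.log n - Real.log m := sub_div_le_log_sub_log hn0 hm0
      _ = _ := by ring

/-- `log` is injective on `[1, N] ⊆ ℕ`. [folklore] -/
lemma log_injOn_Icc (N : ℕ) : Set.InjOn (fun n : ℕ => Real.log n) (Finset.Icc 1 N) := by
  intro m hm n hn h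
  have hm1 : (0 : ℝ) < m := by exact_mod_cast (Finset.mem_Icc.mp hm).1
  have hn1 : (0 : ℝ) < n := by exact_mod_cast (Finset.mem_Icc.mp hn).1
  have := Real.log_injOn_pos (Set.mem_Ioi.mpr hm1) (Set.mem_Ioi.mpr hn1) h
  exact_mod_cast this

/-- Elements of the window `V_k = {n ∈ [1,N] : k(n) ≤ k+1 ∧ k ≤ k(n)+1}` are `< 2^{k+2}`.
[folklore] -/
lemma le_of_mem_window {N k n : ℕ}
    (h : n ∈ (Finset.Icc 1 N).filter fun n => Nat.log 2 n ≤ k + 1 ∧ k ≤ Nat.log 2 n + 1) :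
    (n : ℝ) ≤ 2 ^ (k + 2) := by
  rw [Finset.mem_filter] at h
  have h1 := lt_two_pow_log_succ n
  have h2 : (2 : ℝ) ^ (Nat.log 2 n + 1) ≤ 2 ^ (k + 2) :=
    pow_le_pow_right₀ (by norm_num) (by omega)
  linarith

/-- In the window `V_k`: `2^k ≤ 2n`. [folklore] -/
lemma two_pow_le_of_mem_window {N k n : ℕ}
    (h : n ∈ (Finset.Icc 1 N).filter fun n => Nat.log 2 n ≤ k + 1 ∧ k ≤ Nat.log 2 n + 1) :
    (2 : ℝ) ^ k ≤ 2 * n := by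
  rw [Finset.mem_filter, Finset.mem_Icc] at h
  have h1 := two_pow_log_le h.1.1
  have h2 : (2 : ℝ) ^ k ≤ 2 ^ (Nat.log 2 n + 1) := pow_le_pow_right₀ (by norm_num) h.2.2
  rw [pow_succ] at h2
  linarith

/-- Separation inside a window: for `m, n ∈ V_k`, `2^{-(k+2)} |m - n| ≤ |log m - log n|`.
[folklore] -/
lemma window_separated (N k : ℕ) :
    ∀ m ∈ (Finset.Icc 1 N).filter (fun n => Nat.log 2 n ≤ k + 1 ∧ k ≤ Nat.log 2 n + 1),
      ∀ n ∈ (Finset.Icc 1 N).filter (fun n => Nat.log 2 n ≤ k + 1 ∧ k ≤ Nat.log 2 n + 1),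
        1 / (2 : ℝ) ^ (k + 2) * |(m : ℝ) - n| ≤ |Real.log m - Real.log n| := by
  intro m hm n hn
  rw [one_div_mul_eq_div]
  have hm1 : 1 ≤ m := (Finset.mem_Icc.mp (Finset.mem_filter.mp hm).1).1
  have hn1 : 1 ≤ n := (Finset.mem_Icc.mp (Finset.mem_filter.mp hn).1).1
  exact abs_sub_div_le_abs_log_sub_log hm1 hn1 (le_of_mem_window hm) (le_of_mem_window hn)

/-- Far pairs, one direction: if `k(m) ≥ k(n) + 2` (and `n ≥ 1`) then
`(k(m) - k(n) - 1) log 2 ≤ log m - log n`. [folklore] -/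
lemma log_sub_log_ge_of_far {m n : ℕ} (hn : 1 ≤ n) (h : Nat.log 2 n + 2 ≤ Nat.log 2 m) :
    ((Nat.log 2 m : ℝ) - Nat.log 2 n - 1) * Real.log 2 ≤ Real.log m - Real.log n := by
  have hm : 1 ≤ m := by
    rcases Nat.eq_zero_or_pos m with h0 | h0
    · subst h0; simp at h
    · exact h0
  set d := Nat.log 2 m - Nat.log 2 n with hd
  have hdm : d - 1 + (Nat.log 2 n + 1) = Nat.log 2 m := by omega
  have key : 2 ^ (d - 1) * n < 2 ^ Nat.log 2 m := by
    have h1 : n < 2 ^ (Nat.log 2 n + 1) := Nat.lt_pow_succ_log_self (by norm_num) n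
    calc 2 ^ (d - 1) * n < 2 ^ (d - 1) * 2 ^ (Nat.log 2 n + 1) :=
          (Nat.mul_lt_mul_left (by positivity)).mpr h1
      _ = 2 ^ Nat.log 2 m := by rw [← pow_add, hdm]
  have key' : (2 : ℝ) ^ (d - 1) * n ≤ m := by
    have h2 : 2 ^ Nat.log 2 m ≤ m := Nat.pow_log_le_self 2 (by omega)
    have : 2 ^ (d - 1) * n ≤ m := by omega
    exact_mod_cast this
  have hn0 : (0 : ℝ) < n := by exact_mod_cast hn
  have hm0 : (0 : ℝ) < m := by exact_mod_cast hm
  have hlog := Real.log_le_log (by positivity) key'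
  rw [Real.log_mul (by positivity) hn0.ne', Real.log_pow] at hlog
  have hcast : ((d - 1 : ℕ) : ℝ) = (Nat.log 2 m : ℝ) - Nat.log 2 n - 1 := by
    have : 1 ≤ d := by omega
    rw [Nat.cast_sub this, hd, Nat.cast_sub (by omega)]
    simp
  rw [hcast] at hlog
  linarith

/-- Far pairs: if `m, n ≥ 1` are not block-near then
`(k(m) - k(n))² (log 2)² / 4 ≤ (log m - log n)²`. [folklore] -/
lemma sq_log_sub_log_ge_of_far {m n : ℕ} (hm : 1 ≤ m) (hn : 1 ≤ n)
    (h : ¬(Nat.log 2 m ≤ Nat.log 2 n + 1 ∧ Nat.log 2 n ≤ Nat.log 2 m + 1)) :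
    ((Nat.log 2 m : ℝ) - Nat.log 2 n) ^ 2 * (Real.log 2) ^ 2 / 4 ≤
      (Real.log m - Real.log n) ^ 2 := by
  have hlog2 : 0 < Real.log 2 := Real.log_pos (by norm_num)
  rw [not_and_or, not_le, not_le] at h
  rcases h with h | h
  · -- `k n + 2 ≤ k m`
    have h' : Nat.log 2 n + 2 ≤ Nat.log 2 m := by omega
    have h1 := log_sub_log_ge_of_far hn h'
    have hd : (2 : ℝ) ≤ (Nat.log 2 m : ℝ) - Nat.log 2 n := by
      have : ((Nat.log 2 n + 2 : ℕ) : ℝ) ≤ Nat.log 2 m := by exact_mod_cast h'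
      push_cast at this; linarith
    have h2 : ((Nat.log 2 m : ℝ) - Nat.log 2 n) / 2 * Real.log 2 ≤ Real.log m - Real.log n := by
      refine le_trans ?_ h1
      gcongr
      linarith
    have h3 : 0 ≤ ((Nat.log 2 m : ℝ) - Nat.log 2 n) / 2 * Real.log 2 := by positivity
    calc ((Nat.log 2 m : ℝ) - Nat.log 2 n) ^ 2 * (Real.log 2) ^ 2 / 4
        = (((Nat.log 2 m : ℝ) - Nat.log 2 n) / 2 * Real.log 2) ^ 2 := by ring
      _ ≤ (Real.log m - Real.log n) ^ 2 := pow_le_pow_left₀ h3 h2 2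
  · -- `k m + 2 ≤ k n`
    have h' : Nat.log 2 m + 2 ≤ Nat.log 2 n := by omega
    have h1 := log_sub_log_ge_of_far hm h'
    have hd : (2 : ℝ) ≤ (Nat.log 2 n : ℝ) - Nat.log 2 m := by
      have : ((Nat.log 2 m + 2 : ℕ) : ℝ) ≤ Nat.log 2 n := by exact_mod_cast h'
      push_cast at this; linarith
    have h2 : ((Nat.log 2 n : ℝ) - Nat.log 2 m) / 2 * Real.log 2 ≤ Real.log n - Real.log m := by
      refine le_trans ?_ h1
      gcongr
      linarith
    have h3 : 0 ≤ ((Nat.log 2 n : ℝ) - Nat.log 2 m) / 2 * Real.log 2 := by positivity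
    calc ((Nat.log 2 m : ℝ) - Nat.log 2 n) ^ 2 * (Real.log 2) ^ 2 / 4
        = (((Nat.log 2 n : ℝ) - Nat.log 2 m) / 2 * Real.log 2) ^ 2 := by ring
      _ ≤ (Real.log n - Real.log m) ^ 2 := pow_le_pow_left₀ h3 h2 2
      _ = (Real.log m - Real.log n) ^ 2 := by ring

/-- Far pairs, kernel bound: `1/(2^{k(n)} (L_m - L_n)²) ≤ 4/(2^{k(n)} (k(m)-k(n))² (log 2)²)`.
[folklore] -/
lemma far_kernel_le {m n : ℕ} (hm : 1 ≤ m) (hn : 1 ≤ n)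
    (h : ¬(Nat.log 2 m ≤ Nat.log 2 n + 1 ∧ Nat.log 2 n ≤ Nat.log 2 m + 1)) :
    1 / ((2 : ℝ) ^ Nat.log 2 n * (Real.log m - Real.log n) ^ 2) ≤
      4 / ((2 : ℝ) ^ Nat.log 2 n * (((Nat.log 2 m : ℝ) - Nat.log 2 n) ^ 2 * (Real.log 2) ^ 2)) := by
  have hlog2 : 0 < Real.log 2 := Real.log_pos (by norm_num)
  have hk : ((Nat.log 2 m : ℝ) - Nat.log 2 n) ≠ 0 := by
    have h' := h
    rw [not_and_or, not_le, not_le] at h'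
    rcases h' with h' | h'
    · have : ((Nat.log 2 n + 1 : ℕ) : ℝ) < Nat.log 2 m := by exact_mod_cast h'
      push_cast at this; linarith
    · have : ((Nat.log 2 m + 1 : ℕ) : ℝ) < Nat.log 2 n := by exact_mod_cast h'
      push_cast at this; linarith
  have hD2 : 0 < ((Nat.log 2 m : ℝ) - Nat.log 2 n) ^ 2 * (Real.log 2) ^ 2 :=
    mul_pos (sq_pos_iff.mpr hk) (by positivity)
  have hsq := sq_log_sub_log_ge_of_far hm hn h
  have hc2 : 0 < (Real.log m - Real.log n) ^ 2 := lt_of_lt_of_le (by positivity) hsq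
  have h2n : 0 < (2 : ℝ) ^ Nat.log 2 n := by positivity
  rw [div_le_div_iff₀ (mul_pos h2n hc2) (mul_pos h2n hD2)]
  have h4 : ((Nat.log 2 m : ℝ) - Nat.log 2 n) ^ 2 * (Real.log 2) ^ 2 ≤
      4 * (Real.log m - Real.log n) ^ 2 := by linarith
  calc 1 * ((2 : ℝ) ^ Nat.log 2 n * (((Nat.log 2 m : ℝ) - Nat.log 2 n) ^ 2 * (Real.log 2) ^ 2))
      ≤ 1 * ((2 : ℝ) ^ Nat.log 2 n * (4 * (Real.log m - Real.log n) ^ 2)) := by gcongr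
    _ = 4 * ((2 : ℝ) ^ Nat.log 2 n * (Real.log m - Real.log n) ^ 2) := by ring

/-- The fibre `{n ∈ T : k(n) = l}` of the dyadic block map has at most `2^l` elements (for
`T` a set of positive integers). [folklore] -/
lemma card_filter_log_eq_le (T : Finset ℕ) (hT : ∀ n ∈ T, 1 ≤ n) (l : ℕ) :
    ((T.filter fun n => Nat.log 2 n = l).card : ℝ) ≤ 2 ^ l := by
  have hsub : (T.filter fun n => Nat.log 2 n = l) ⊆ Finset.Ico (2 ^ l) (2 ^ (l + 1)) := by
    intro n hn
    rw [Finset.mem_filter] at hn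
    rw [Finset.mem_Ico]
    have h1 := Nat.lt_pow_succ_log_self (b := 2) (by norm_num) n
    rw [hn.2] at h1
    refine ⟨?_, h1⟩
    have h0 : n ≠ 0 := by have := hT n hn.1; omega
    have := Nat.pow_log_le_self 2 h0
    rw [hn.2] at this
    exact this
  have := Finset.card_le_card hsub
  rw [Nat.card_Ico] at this
  have h2 : 2 ^ (l + 1) - 2 ^ l = 2 ^ l := by rw [pow_succ]; omega
  rw [h2] at this
  exact_mod_cast this

/-- The far row sums: for `m ∈ [1, N]`,
`∑_{n ≤ N, (m,n) far} 1/(2^{k(n)} (L_m - L_n)²) ≤ 16/(log 2)²`. [folklore] -/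
lemma far_rowsum_le {N m : ℕ} (hm : m ∈ Finset.Icc 1 N) :
    ∑ n ∈ (Finset.Icc 1 N).filter
        (fun n => ¬(Nat.log 2 m ≤ Nat.log 2 n + 1 ∧ Nat.log 2 n ≤ Nat.log 2 m + 1)),
        1 / ((2 : ℝ) ^ Nat.log 2 n * (Real.log m - Real.log n) ^ 2) ≤ 16 / (Real.log 2) ^ 2 := by
  classical
  have hlog2 : 0 < Real.log 2 := Real.log_pos (by norm_num)
  have hm1 : 1 ≤ m := (Finset.mem_Icc.mp hm).1
  set T := (Finset.Icc 1 N).filter (fun n => Nat.log 2 n ≠ Nat.log 2 m) with hT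
  set f : ℕ → ℝ := fun l =>
    4 / ((2 : ℝ) ^ l * (((Nat.log 2 m : ℝ) - l) ^ 2 * (Real.log 2) ^ 2)) with hf
  have hf0 : ∀ l, 0 ≤ f l := fun l => by positivity
  -- Step 1: termwise bound and enlarging the index set
  have step1 : ∑ n ∈ (Finset.Icc 1 N).filter
        (fun n => ¬(Nat.log 2 m ≤ Nat.log 2 n + 1 ∧ Nat.log 2 n ≤ Nat.log 2 m + 1)),
      1 / ((2 : ℝ) ^ Nat.log 2 n * (Real.log m - Real.log n) ^ 2) ≤ ∑ n ∈ T, f (Nat.log 2 n) := by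
    calc ∑ n ∈ (Finset.Icc 1 N).filter
          (fun n => ¬(Nat.log 2 m ≤ Nat.log 2 n + 1 ∧ Nat.log 2 n ≤ Nat.log 2 m + 1)),
          1 / ((2 : ℝ) ^ Nat.log 2 n * (Real.log m - Real.log n) ^ 2)
        ≤ ∑ n ∈ (Finset.Icc 1 N).filter
            (fun n => ¬(Nat.log 2 m ≤ Nat.log 2 n + 1 ∧ Nat.log 2 n ≤ Nat.log 2 m + 1)),
            f (Nat.log 2 n) := by
          refine Finset.sum_le_sum fun n hn => ?_
          rw [Finset.mem_filter, Finset.mem_Icc] at hn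
          exact far_kernel_le hm1 hn.1.1 hn.2
      _ ≤ ∑ n ∈ T, f (Nat.log 2 n) := by
          refine Finset.sum_le_sum_of_subset_of_nonneg ?_ fun n _ _ => hf0 _
          intro n hn
          rw [Finset.mem_filter] at hn ⊢
          refine ⟨hn.1, fun heq => hn.2 ?_⟩
          omega
  -- Step 2: group by the block index
  have hmaps : ∀ n ∈ T, Nat.log 2 n ∈ (Finset.range (N + 1)).erase (Nat.log 2 m) := by
    intro n hn
    rw [hT, Finset.mem_filter, Finset.mem_Icc] at hn
    rw [Finset.mem_erase, Finset.mem_range]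
    refine ⟨hn.2, ?_⟩
    have := Nat.log_le_self 2 n
    omega
  have step2 : ∑ n ∈ T, f (Nat.log 2 n) =
      ∑ l ∈ (Finset.range (N + 1)).erase (Nat.log 2 m),
        ((T.filter fun n => Nat.log 2 n = l).card : ℝ) * f l := by
    rw [← Finset.sum_fiberwise_of_maps_to hmaps]
    refine Finset.sum_congr rfl fun l _ => ?_
    rw [Finset.sum_congr rfl (g := fun _ => f l) (fun n hn => by
      rw [Finset.mem_filter] at hn; rw [hn.2]), Finset.sum_const, nsmul_eq_mul]
  -- Step 3: each fibre has at most `2^l` elements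
  have step3 : ∑ l ∈ (Finset.range (N + 1)).erase (Nat.log 2 m),
      ((T.filter fun n => Nat.log 2 n = l).card : ℝ) * f l ≤
      ∑ l ∈ (Finset.range (N + 1)).erase (Nat.log 2 m),
        4 / (Real.log 2) ^ 2 * (1 / ((Nat.log 2 m : ℝ) - l) ^ 2) := by
    refine Finset.sum_le_sum fun l hl => ?_
    have hl' : ((Nat.log 2 m : ℝ) - l) ≠ 0 := by
      rw [Finset.mem_erase] at hl
      rw [sub_ne_zero]
      exact_mod_cast (Ne.symm hl.1)
    have hT1 : ∀ n ∈ T, 1 ≤ n := fun n hn => by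
      rw [hT, Finset.mem_filter, Finset.mem_Icc] at hn
      exact hn.1.1
    calc ((T.filter fun n => Nat.log 2 n = l).card : ℝ) * f l ≤ 2 ^ l * f l := by
          gcongr
          exact card_filter_log_eq_le T hT1 l
      _ = 4 / (Real.log 2) ^ 2 * (1 / ((Nat.log 2 m : ℝ) - l) ^ 2) := by
          simp only [hf]
          field_simp
  -- Step 4: `∑_{l ≠ k(m)} 1/(k(m) - l)² ≤ 4`
  have step4 : ∑ l ∈ (Finset.range (N + 1)).erase (Nat.log 2 m),
      4 / (Real.log 2) ^ 2 * (1 / ((Nat.log 2 m : ℝ) - l) ^ 2) ≤ 4 / (Real.log 2) ^ 2 * 4 := by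
    rw [← Finset.mul_sum]
    gcongr
    exact HilbertIneq.sum_inv_sq_natSub_le _ _
  calc _ ≤ _ := step1
    _ = _ := step2
    _ ≤ _ := step3
    _ ≤ 4 / (Real.log 2) ^ 2 * 4 := step4
    _ = 16 / (Real.log 2) ^ 2 := by ring

/-- Swapping a double sum over ordered pairs of distinct elements restricted by a symmetric
relation. [folklore] -/
lemma sum_erase_filter_comm {M : Type*} [AddCommMonoid M] (S : Finset ℕ) (p : ℕ → ℕ → Prop)
    [DecidableRel p] (hp : ∀ m n, p m n → p n m) (f : ℕ → ℕ → M) :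
    ∑ m ∈ S, ∑ n ∈ (S.erase m).filter (p m), f m n =
      ∑ n ∈ S, ∑ m ∈ (S.erase n).filter (p n), f m n := by
  apply Finset.sum_comm'
  intro m n
  simp only [Finset.mem_filter, Finset.mem_erase]
  constructor
  · rintro ⟨hm, ⟨hnm, hn⟩, hp'⟩
    exact ⟨⟨⟨Ne.symm hnm, hm⟩, hp m n hp'⟩, hn⟩
  · rintro ⟨⟨⟨hmn, hm⟩, hp'⟩, hn⟩
    exact ⟨hm, ⟨Ne.symm hmn, hn⟩, hp n m hp'⟩

/-- The number of block-near `n ≤ N` of a given `m ≥ 1` is at most `4m`. [folklore] -/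
lemma card_near_le {N m : ℕ} (hm : 1 ≤ m) :
    ((((Finset.Icc 1 N).erase m).filter
        fun n => Nat.log 2 m ≤ Nat.log 2 n + 1 ∧ Nat.log 2 n ≤ Nat.log 2 m + 1).card : ℝ) ≤
      4 * m := by
  have hsub : (((Finset.Icc 1 N).erase m).filter
      fun n => Nat.log 2 m ≤ Nat.log 2 n + 1 ∧ Nat.log 2 n ≤ Nat.log 2 m + 1) ⊆
      Finset.range (4 * 2 ^ Nat.log 2 m) := by
    intro n hn
    rw [Finset.mem_filter] at hn
    rw [Finset.mem_range]
    have h1 : n < 2 ^ (Nat.log 2 n + 1) := Nat.lt_pow_succ_log_self (by norm_num) n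
    have h2 : 2 ^ (Nat.log 2 n + 1) ≤ 2 ^ (Nat.log 2 m + 2) :=
      Nat.pow_le_pow_right (by norm_num) (by have := hn.2.2; omega)
    have h3 : 2 ^ (Nat.log 2 m + 2) = 4 * 2 ^ Nat.log 2 m := by rw [pow_add]; ring
    omega
  have h := Finset.card_le_card hsub
  rw [Finset.card_range] at h
  have h4 : 2 ^ Nat.log 2 m ≤ m := Nat.pow_log_le_self 2 (by omega)
  have : (((Finset.Icc 1 N).erase m).filter
      fun n => Nat.log 2 m ≤ Nat.log 2 n + 1 ∧ Nat.log 2 n ≤ Nat.log 2 m + 1).card ≤ 4 * m := by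
    omega
  exact_mod_cast this

/-- `|e^{ic} - 1 - ic| ≤ 3 c²` for real `c`. [folklore] -/
lemma norm_exp_sub_one_sub_le (c : ℝ) : ‖cexp (↑c * I) - 1 - ↑c * I‖ ≤ 3 * c ^ 2 := by
  have hcI : ‖(c : ℂ) * I‖ = |c| := by
    rw [norm_mul, Complex.norm_I, mul_one, Complex.norm_real, Real.norm_eq_abs]
  rcases le_or_gt |c| 1 with h | h
  · have := Complex.norm_exp_sub_one_sub_id_le (x := (c : ℂ) * I) (by rw [hcI]; exact h)
    rw [hcI, sq_abs] at this
    nlinarith [sq_nonneg c]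
  · have h1 : ‖cexp (↑c * I) - 1 - ↑c * I‖ ≤ 2 + |c| := by
      refine (norm_sub_le _ _).trans ?_
      rw [hcI]
      gcongr
      refine (norm_sub_le _ _).trans ?_
      rw [Complex.norm_exp_ofReal_mul_I, norm_one]
      norm_num
    have h2 : |c| ^ 2 = c ^ 2 := sq_abs c
    nlinarith

/-- The near kernel is `i/c + O(1)`: for real `c ≠ 0`,
`|(e^{ic} - 1)/c² - i/c| ≤ 3`. [folklore] -/
lemma norm_near_kernel_sub_le {c : ℝ} (hc : c ≠ 0) :
    ‖(cexp (↑c * I * ↑(1 : ℝ)) - 1) / ((c ^ 2 : ℝ) : ℂ) - I / (c : ℂ)‖ ≤ 3 := by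
  have hc' : (c : ℂ) ≠ 0 := Complex.ofReal_ne_zero.mpr hc
  have heq : (cexp (↑c * I * ↑(1 : ℝ)) - 1) / ((c ^ 2 : ℝ) : ℂ) - I / (c : ℂ) =
      (cexp (↑c * I) - 1 - ↑c * I) / ((c ^ 2 : ℝ) : ℂ) := by
    push_cast
    rw [mul_one]
    field_simp
  rw [heq, norm_div, Complex.norm_real, Real.norm_eq_abs, abs_of_nonneg (sq_nonneg c),
    div_le_iff₀ (by positivity)]
  exact norm_exp_sub_one_sub_le c

/-! ### The three parts of the remainder -/

/-- **Far part.** `|∑_{(m,n) far} a_m ā_n (e^{i(L_m-L_n)} - 1)/(L_m - L_n)²| ≤ 67 ∑ n |a_n|²`.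
[folklore] -/
lemma norm_farPart_le (N : ℕ) (b : ℕ → ℂ) :
    ‖∑ m ∈ Finset.Icc 1 N, ∑ n ∈ ((Finset.Icc 1 N).erase m).filter
        (fun n => ¬(Nat.log 2 m ≤ Nat.log 2 n + 1 ∧ Nat.log 2 n ≤ Nat.log 2 m + 1)),
        b m * conj (b n) * (cexp (↑(Real.log m - Real.log n) * I * ↑(1 : ℝ)) - 1) /
          (((Real.log m - Real.log n) ^ 2 : ℝ) : ℂ)‖ ≤
      67 * ∑ n ∈ Finset.Icc 1 N, (n : ℝ) * ‖b n‖ ^ 2 := by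
  classical
  set S := Finset.Icc 1 N with hS
  -- the "far" relation
  set far : ℕ → ℕ → Prop := fun m n =>
    ¬(Nat.log 2 m ≤ Nat.log 2 n + 1 ∧ Nat.log 2 n ≤ Nat.log 2 m + 1) with hfar
  have hfar_symm : ∀ m n, far m n → far n m := fun m n h h' => h ⟨h'.2, h'.1⟩
  have hlog2 : 0 < Real.log 2 := Real.log_pos (by norm_num)
  have hlog2' : (0.6931471803 : ℝ) < Real.log 2 := Real.log_two_gt_d9
  -- weights
  set w : ℕ → ℝ := fun n => (2 : ℝ) ^ Nat.log 2 n with hw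
  have hw0 : ∀ n, 0 < w n := fun n => by positivity
  set K : ℕ → ℕ → ℝ := fun m n => 1 / (w n * (Real.log m - Real.log n) ^ 2) with hK
  have hK0 : ∀ m n, 0 ≤ K m n := fun m n => by positivity
  change ‖∑ m ∈ S, ∑ n ∈ (S.erase m).filter (far m),
      b m * conj (b n) * (cexp (↑(Real.log m - Real.log n) * I * ↑(1 : ℝ)) - 1) /
        (((Real.log m - Real.log n) ^ 2 : ℝ) : ℂ)‖ ≤ 67 * ∑ n ∈ S, (n : ℝ) * ‖b n‖ ^ 2
  -- Step 1: norms inside, termwise bound `2 |b m| |b n| / c²`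
  have step1 : ‖∑ m ∈ S, ∑ n ∈ (S.erase m).filter (far m),
        b m * conj (b n) * (cexp (↑(Real.log m - Real.log n) * I * ↑(1 : ℝ)) - 1) /
          (((Real.log m - Real.log n) ^ 2 : ℝ) : ℂ)‖ ≤
      ∑ m ∈ S, ∑ n ∈ (S.erase m).filter (far m),
        2 * (‖b m‖ * ‖b n‖ / (Real.log m - Real.log n) ^ 2) := by
    refine (norm_sum_le _ _).trans (Finset.sum_le_sum fun m _ => ?_)
    refine (norm_sum_le _ _).trans (Finset.sum_le_sum fun n _ => ?_)
    exact HilbertIneq.norm_remainder_term_le (b m) (b n) _ _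
  -- Step 2: weighted AM–GM
  have step2 : ∀ m n, 2 * (‖b m‖ * ‖b n‖ / (Real.log m - Real.log n) ^ 2) ≤
      ‖b m‖ ^ 2 * w m * K m n + ‖b n‖ ^ 2 * w n * K n m := by
    intro m n
    have hsymm : (Real.log n - Real.log m) ^ 2 = (Real.log m - Real.log n) ^ 2 := by ring
    simp only [hK, hsymm]
    rcases eq_or_ne ((Real.log m - Real.log n) ^ 2) 0 with h0 | h0
    · rw [h0]; simp
    · have hc2 : 0 < (Real.log m - Real.log n) ^ 2 := lt_of_le_of_ne (sq_nonneg _) (Ne.symm h0)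
      have hwm := hw0 m
      have hwn := hw0 n
      rw [show ‖b m‖ ^ 2 * w m * (1 / (w n * (Real.log ↑m - Real.log ↑n) ^ 2)) +
          ‖b n‖ ^ 2 * w n * (1 / (w m * (Real.log ↑m - Real.log ↑n) ^ 2)) =
          (‖b m‖ ^ 2 * (w m / w n) + ‖b n‖ ^ 2 * (w n / w m)) / (Real.log m - Real.log n) ^ 2 by
        field_simp]
      rw [← mul_div_assoc, div_le_div_iff_of_pos_right hc2]
      -- `2xy ≤ x² t + y²/t` with `t = w m / w n`
      have ht : 0 < w m / w n := div_pos hwm hwn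
      have key : 0 ≤ (‖b m‖ * (w m / w n) - ‖b n‖) ^ 2 / (w m / w n) := by positivity
      have expand : (‖b m‖ * (w m / w n) - ‖b n‖) ^ 2 / (w m / w n) =
          ‖b m‖ ^ 2 * (w m / w n) + ‖b n‖ ^ 2 * (w n / w m) - 2 * (‖b m‖ * ‖b n‖) := by
        field_simp
        ring
      linarith
  -- Step 3: sum the two halves; the second is the first after swapping
  have step3 : ∑ m ∈ S, ∑ n ∈ (S.erase m).filter (far m),
        2 * (‖b m‖ * ‖b n‖ / (Real.log m - Real.log n) ^ 2) ≤
      2 * ∑ m ∈ S, ‖b m‖ ^ 2 * w m * ∑ n ∈ (S.erase m).filter (far m), K m n := by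
    calc ∑ m ∈ S, ∑ n ∈ (S.erase m).filter (far m),
          2 * (‖b m‖ * ‖b n‖ / (Real.log m - Real.log n) ^ 2)
        ≤ ∑ m ∈ S, ∑ n ∈ (S.erase m).filter (far m),
            (‖b m‖ ^ 2 * w m * K m n + ‖b n‖ ^ 2 * w n * K n m) :=
          Finset.sum_le_sum fun m _ => Finset.sum_le_sum fun n _ => step2 m n
      _ = ∑ m ∈ S, ∑ n ∈ (S.erase m).filter (far m), ‖b m‖ ^ 2 * w m * K m n +
          ∑ m ∈ S, ∑ n ∈ (S.erase m).filter (far m), ‖b n‖ ^ 2 * w n * K n m := by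
          rw [← Finset.sum_add_distrib]
          exact Finset.sum_congr rfl fun m _ => Finset.sum_add_distrib
      _ = ∑ m ∈ S, ∑ n ∈ (S.erase m).filter (far m), ‖b m‖ ^ 2 * w m * K m n +
          ∑ n ∈ S, ∑ m ∈ (S.erase n).filter (far n), ‖b n‖ ^ 2 * w n * K n m := by
          congr 1
          exact sum_erase_filter_comm S far hfar_symm _
      _ = 2 * ∑ m ∈ S, ‖b m‖ ^ 2 * w m * ∑ n ∈ (S.erase m).filter (far m), K m n := by
          rw [two_mul]
          congr 1 <;> exact Finset.sum_congr rfl fun m _ => by rw [Finset.mul_sum]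
  -- Step 4: the row sums
  have step4 : ∀ m ∈ S, ∑ n ∈ (S.erase m).filter (far m), K m n ≤ 16 / (Real.log 2) ^ 2 := by
    intro m hm
    calc ∑ n ∈ (S.erase m).filter (far m), K m n ≤ ∑ n ∈ S.filter (far m), K m n := by
          refine Finset.sum_le_sum_of_subset_of_nonneg ?_ fun n _ _ => hK0 m n
          intro n hn
          rw [Finset.mem_filter] at hn ⊢
          exact ⟨Finset.mem_of_mem_erase hn.1, hn.2⟩
      _ ≤ 16 / (Real.log 2) ^ 2 := far_rowsum_le hm
  -- Step 5: `w m ≤ m`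
  have step5 : ∑ m ∈ S, ‖b m‖ ^ 2 * w m * ∑ n ∈ (S.erase m).filter (far m), K m n ≤
      ∑ m ∈ S, (m : ℝ) * ‖b m‖ ^ 2 * (16 / (Real.log 2) ^ 2) := by
    refine Finset.sum_le_sum fun m hm => ?_
    have hm1 : 1 ≤ m := (Finset.mem_Icc.mp hm).1
    have hwm : w m ≤ m := two_pow_log_le hm1
    have hrow := step4 m hm
    have hrow0 : 0 ≤ ∑ n ∈ (S.erase m).filter (far m), K m n :=
      Finset.sum_nonneg fun n _ => hK0 m n
    calc ‖b m‖ ^ 2 * w m * ∑ n ∈ (S.erase m).filter (far m), K m n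
        ≤ ‖b m‖ ^ 2 * m * (16 / (Real.log 2) ^ 2) := by gcongr
      _ = (m : ℝ) * ‖b m‖ ^ 2 * (16 / (Real.log 2) ^ 2) := by ring
  have hB0 : 0 ≤ ∑ n ∈ S, (n : ℝ) * ‖b n‖ ^ 2 := Finset.sum_nonneg fun n _ => by positivity
  have hconst : 2 * (16 / (Real.log 2) ^ 2) ≤ 67 := by
    rw [← le_div_iff₀' (by norm_num : (0 : ℝ) < 2), div_le_iff₀ (by positivity)]
    nlinarith
  calc _ ≤ _ := step1
    _ ≤ _ := step3
    _ ≤ 2 * ∑ m ∈ S, (m : ℝ) * ‖b m‖ ^ 2 * (16 / (Real.log 2) ^ 2) := by gcongr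
    _ = 2 * (16 / (Real.log 2) ^ 2) * ∑ m ∈ S, (m : ℝ) * ‖b m‖ ^ 2 := by
        rw [← Finset.sum_mul]; ring
    _ ≤ 67 * ∑ n ∈ S, (n : ℝ) * ‖b n‖ ^ 2 := by gcongr

/-- **Near part, bounded kernel.** `∑_{(m,n) near} |a_m||a_n| ≤ 4 ∑ n|a_n|²`. [folklore] -/
lemma sum_near_norm_mul_le (N : ℕ) (b : ℕ → ℂ) :
    ∑ m ∈ Finset.Icc 1 N, ∑ n ∈ ((Finset.Icc 1 N).erase m).filter
        (fun n => Nat.log 2 m ≤ Nat.log 2 n + 1 ∧ Nat.log 2 n ≤ Nat.log 2 m + 1),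
        ‖b m‖ * ‖b n‖ ≤ 4 * ∑ n ∈ Finset.Icc 1 N, (n : ℝ) * ‖b n‖ ^ 2 := by
  classical
  set S := Finset.Icc 1 N with hS
  set near : ℕ → ℕ → Prop := fun m n =>
    Nat.log 2 m ≤ Nat.log 2 n + 1 ∧ Nat.log 2 n ≤ Nat.log 2 m + 1 with hnear
  have hnear_symm : ∀ m n, near m n → near n m := fun m n h => ⟨h.2, h.1⟩
  change ∑ m ∈ S, ∑ n ∈ (S.erase m).filter (near m), ‖b m‖ * ‖b n‖ ≤
    4 * ∑ n ∈ S, (n : ℝ) * ‖b n‖ ^ 2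
  calc ∑ m ∈ S, ∑ n ∈ (S.erase m).filter (near m), ‖b m‖ * ‖b n‖
      ≤ ∑ m ∈ S, ∑ n ∈ (S.erase m).filter (near m), (‖b m‖ ^ 2 / 2 + ‖b n‖ ^ 2 / 2) :=
        Finset.sum_le_sum fun m _ => Finset.sum_le_sum fun n _ => by
          nlinarith [sq_nonneg (‖b m‖ - ‖b n‖)]
    _ = ∑ m ∈ S, ∑ n ∈ (S.erase m).filter (near m), ‖b m‖ ^ 2 / 2 +
          ∑ m ∈ S, ∑ n ∈ (S.erase m).filter (near m), ‖b n‖ ^ 2 / 2 := by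
        rw [← Finset.sum_add_distrib]
        exact Finset.sum_congr rfl fun m _ => Finset.sum_add_distrib
    _ = ∑ m ∈ S, ∑ n ∈ (S.erase m).filter (near m), ‖b m‖ ^ 2 / 2 +
          ∑ n ∈ S, ∑ m ∈ (S.erase n).filter (near n), ‖b n‖ ^ 2 / 2 := by
        congr 1
        exact sum_erase_filter_comm S near hnear_symm _
    _ = ∑ m ∈ S, (((S.erase m).filter (near m)).card : ℝ) * ‖b m‖ ^ 2 := by
        rw [← Finset.sum_add_distrib]
        refine Finset.sum_congr rfl fun m _ => ?_
        rw [Finset.sum_const, nsmul_eq_mul]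
        ring
    _ ≤ ∑ m ∈ S, 4 * m * ‖b m‖ ^ 2 := by
        refine Finset.sum_le_sum fun m hm => ?_
        gcongr
        exact card_near_le (Finset.mem_Icc.mp hm).1
    _ = 4 * ∑ n ∈ S, (n : ℝ) * ‖b n‖ ^ 2 := by
        rw [Finset.mul_sum]
        exact Finset.sum_congr rfl fun n _ => by ring

/-- **Near part, singular kernel: the block decomposition.**  The near-truncated Hilbert form is a
sum over `k` of Hilbert forms on the windows `V_k` (with first argument restricted to the block
`k(m) = k`). [folklore] -/
lemma nearForm_eq_sum_window (N : ℕ) (b : ℕ → ℂ) :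
    ∑ m ∈ Finset.Icc 1 N, ∑ n ∈ ((Finset.Icc 1 N).erase m).filter
        (fun n => Nat.log 2 m ≤ Nat.log 2 n + 1 ∧ Nat.log 2 n ≤ Nat.log 2 m + 1),
        b m * conj (b n) / ((Real.log m - Real.log n : ℝ) : ℂ) =
      ∑ k ∈ Finset.range (N + 1),
        ∑ m ∈ (Finset.Icc 1 N).filter (fun n => Nat.log 2 n ≤ k + 1 ∧ k ≤ Nat.log 2 n + 1),
          ∑ n ∈ ((Finset.Icc 1 N).filter
              (fun n => Nat.log 2 n ≤ k + 1 ∧ k ≤ Nat.log 2 n + 1)).erase m,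
            (if Nat.log 2 m = k then b m else 0) * conj (b n) /
              ((Real.log m - Real.log n : ℝ) : ℂ) := by
  classical
  set S := Finset.Icc 1 N with hS
  have hmaps : ∀ m ∈ S, Nat.log 2 m ∈ Finset.range (N + 1) := by
    intro m hm
    rw [Finset.mem_range]
    have := Nat.log_le_self 2 m
    have := (Finset.mem_Icc.mp hm).2
    omega
  rw [← Finset.sum_fiberwise_of_maps_to hmaps]
  refine Finset.sum_congr rfl fun k _ => ?_
  set W := S.filter (fun n => Nat.log 2 n ≤ k + 1 ∧ k ≤ Nat.log 2 n + 1) with hW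
  -- right-hand side: only `m` with `k(m) = k` contribute
  rw [← Finset.sum_filter_add_sum_filter_not W (fun m => Nat.log 2 m = k)]
  rw [Finset.sum_eq_zero (s := W.filter fun m => ¬Nat.log 2 m = k) (fun m hm => by
    rw [Finset.mem_filter] at hm
    simp [hm.2]), add_zero]
  have hfilt : W.filter (fun m => Nat.log 2 m = k) = S.filter (fun m => Nat.log 2 m = k) := by
    ext m
    simp only [hW, Finset.mem_filter]
    constructor
    · rintro ⟨⟨h1, _⟩, h2⟩; exact ⟨h1, h2⟩
    · rintro ⟨h1, h2⟩; exact ⟨⟨h1, by omega, by omega⟩, h2⟩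
  rw [hfilt]
  refine Finset.sum_congr rfl fun m hm => ?_
  rw [Finset.mem_filter] at hm
  have hset : (S.erase m).filter
      (fun n => Nat.log 2 m ≤ Nat.log 2 n + 1 ∧ Nat.log 2 n ≤ Nat.log 2 m + 1) = W.erase m := by
    ext n
    simp only [Finset.mem_filter, Finset.mem_erase, hW]
    constructor
    · rintro ⟨⟨h1, h2⟩, h3, h4⟩; exact ⟨h1, h2, by omega, by omega⟩
    · rintro ⟨h1, h2, h3, h4⟩; exact ⟨⟨h1, h2⟩, by omega, by omega⟩
  rw [hset]
  refine Finset.sum_congr rfl fun n _ => ?_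
  rw [if_pos hm.2]

/-- Norm bound for one window form: `|H_{V_k}(b^{(k)}, b)| ≤ 128 ∑_{n ∈ V_k} n |b_n|²`.
[folklore] -/
lemma norm_windowForm_le (N k : ℕ) (b : ℕ → ℂ) :
    ‖∑ m ∈ (Finset.Icc 1 N).filter (fun n => Nat.log 2 n ≤ k + 1 ∧ k ≤ Nat.log 2 n + 1),
        ∑ n ∈ ((Finset.Icc 1 N).filter
            (fun n => Nat.log 2 n ≤ k + 1 ∧ k ≤ Nat.log 2 n + 1)).erase m,
          (if Nat.log 2 m = k then b m else 0) * conj (b n) /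
            ((Real.log m - Real.log n : ℝ) : ℂ)‖ ≤
      128 * ∑ n ∈ (Finset.Icc 1 N).filter (fun n => Nat.log 2 n ≤ k + 1 ∧ k ≤ Nat.log 2 n + 1),
        (n : ℝ) * ‖b n‖ ^ 2 := by
  set W := (Finset.Icc 1 N).filter (fun n => Nat.log 2 n ≤ k + 1 ∧ k ≤ Nat.log 2 n + 1) with hW
  have hδ : (0 : ℝ) < 1 / (2 : ℝ) ^ (k + 2) := by positivity
  have h := norm_hilbertForm_le_of_separated W (fun n => Real.log n)
    (fun m => if Nat.log 2 m = k then b m else 0) b hδ (window_separated N k)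
  refine h.trans ?_
  have h1 : ∑ n ∈ W, ‖(if Nat.log 2 n = k then b n else 0)‖ ^ 2 ≤ ∑ n ∈ W, ‖b n‖ ^ 2 := by
    refine Finset.sum_le_sum fun n _ => ?_
    split_ifs <;> simp
  have h2 : 8 / (1 / (2 : ℝ) ^ (k + 2)) = 2 ^ k * 32 := by
    field_simp
    ring
  rw [h2]
  calc (2 : ℝ) ^ k * 32 * (∑ n ∈ W, ‖(if Nat.log 2 n = k then b n else 0)‖ ^ 2 +
        ∑ n ∈ W, ‖b n‖ ^ 2)
      ≤ 2 ^ k * 32 * (∑ n ∈ W, ‖b n‖ ^ 2 + ∑ n ∈ W, ‖b n‖ ^ 2) := by gcongr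
    _ = ∑ n ∈ W, 2 ^ k * 64 * ‖b n‖ ^ 2 := by
        rw [← two_mul, Finset.mul_sum, Finset.mul_sum]
        exact Finset.sum_congr rfl fun n _ => by ring
    _ ≤ ∑ n ∈ W, 128 * ((n : ℝ) * ‖b n‖ ^ 2) := by
        refine Finset.sum_le_sum fun n hn => ?_
        have := two_pow_le_of_mem_window hn
        nlinarith [sq_nonneg ‖b n‖]
    _ = 128 * ∑ n ∈ W, (n : ℝ) * ‖b n‖ ^ 2 := by rw [Finset.mul_sum]

/-- Each `n` lies in at most three windows: `∑_k ∑_{n ∈ V_k} g(n) ≤ 3 ∑_{n ≤ N} g(n)` for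
`g ≥ 0`. [folklore] -/
lemma sum_sum_window_le (N : ℕ) (g : ℕ → ℝ) (hg : ∀ n, 0 ≤ g n) :
    ∑ k ∈ Finset.range (N + 1),
      ∑ n ∈ (Finset.Icc 1 N).filter (fun n => Nat.log 2 n ≤ k + 1 ∧ k ≤ Nat.log 2 n + 1), g n ≤
      3 * ∑ n ∈ Finset.Icc 1 N, g n := by
  classical
  have hcomm : ∑ k ∈ Finset.range (N + 1),
      ∑ n ∈ (Finset.Icc 1 N).filter (fun n => Nat.log 2 n ≤ k + 1 ∧ k ≤ Nat.log 2 n + 1), g n =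
      ∑ n ∈ Finset.Icc 1 N, ∑ k ∈ (Finset.range (N + 1)).filter
        (fun k => Nat.log 2 n ≤ k + 1 ∧ k ≤ Nat.log 2 n + 1), g n := by
    apply Finset.sum_comm'
    intro k n
    simp only [Finset.mem_filter]
    tauto
  rw [hcomm, Finset.mul_sum]
  refine Finset.sum_le_sum fun n _ => ?_
  rw [Finset.sum_const, nsmul_eq_mul]
  have hcard : ((Finset.range (N + 1)).filter
      (fun k => Nat.log 2 n ≤ k + 1 ∧ k ≤ Nat.log 2 n + 1)).card ≤ 3 := by
    calc _ ≤ (Finset.Icc (Nat.log 2 n - 1) (Nat.log 2 n + 1)).card := by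
          refine Finset.card_le_card fun k hk => ?_
          rw [Finset.mem_filter] at hk
          rw [Finset.mem_Icc]
          omega
      _ ≤ 3 := by rw [Nat.card_Icc]; omega
  have : (((Finset.range (N + 1)).filter
      (fun k => Nat.log 2 n ≤ k + 1 ∧ k ≤ Nat.log 2 n + 1)).card : ℝ) ≤ 3 := by
    exact_mod_cast hcard
  have := hg n
  nlinarith

/-- **Near part, singular kernel.** `|∑_{(m,n) near} a_m ā_n/(L_m - L_n)| ≤ 384 ∑ n|a_n|²`.
[folklore] -/
lemma norm_nearForm_le (N : ℕ) (b : ℕ → ℂ) :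
    ‖∑ m ∈ Finset.Icc 1 N, ∑ n ∈ ((Finset.Icc 1 N).erase m).filter
        (fun n => Nat.log 2 m ≤ Nat.log 2 n + 1 ∧ Nat.log 2 n ≤ Nat.log 2 m + 1),
        b m * conj (b n) / ((Real.log m - Real.log n : ℝ) : ℂ)‖ ≤
      384 * ∑ n ∈ Finset.Icc 1 N, (n : ℝ) * ‖b n‖ ^ 2 := by
  rw [nearForm_eq_sum_window]
  refine (norm_sum_le _ _).trans ?_
  calc ∑ k ∈ Finset.range (N + 1),
        ‖∑ m ∈ (Finset.Icc 1 N).filter (fun n => Nat.log 2 n ≤ k + 1 ∧ k ≤ Nat.log 2 n + 1),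
          ∑ n ∈ ((Finset.Icc 1 N).filter
              (fun n => Nat.log 2 n ≤ k + 1 ∧ k ≤ Nat.log 2 n + 1)).erase m,
            (if Nat.log 2 m = k then b m else 0) * conj (b n) /
              ((Real.log m - Real.log n : ℝ) : ℂ)‖
      ≤ ∑ k ∈ Finset.range (N + 1), 128 *
          ∑ n ∈ (Finset.Icc 1 N).filter (fun n => Nat.log 2 n ≤ k + 1 ∧ k ≤ Nat.log 2 n + 1),
            (n : ℝ) * ‖b n‖ ^ 2 :=
        Finset.sum_le_sum fun k _ => norm_windowForm_le N k b
    _ = 128 * ∑ k ∈ Finset.range (N + 1),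
          ∑ n ∈ (Finset.Icc 1 N).filter (fun n => Nat.log 2 n ≤ k + 1 ∧ k ≤ Nat.log 2 n + 1),
            (n : ℝ) * ‖b n‖ ^ 2 := by
        rw [Finset.mul_sum]
    _ ≤ 128 * (3 * ∑ n ∈ Finset.Icc 1 N, (n : ℝ) * ‖b n‖ ^ 2) := by
        gcongr
        exact sum_sum_window_le N _ fun n => by positivity
    _ = 384 * ∑ n ∈ Finset.Icc 1 N, (n : ℝ) * ‖b n‖ ^ 2 := by ring

/-- **The remainder for `log n`.**  With `L_n = log n`,
`|∑_{m ≠ n ≤ N} a_m ā_n (e^{i(L_m - L_n)} - 1)/(L_m - L_n)²| ≤ 463 ∑_{n ≤ N} n |a_n|²`.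
[folklore] -/
theorem norm_logRemainder_le (N : ℕ) (b : ℕ → ℂ) :
    ‖∑ m ∈ Finset.Icc 1 N, ∑ n ∈ (Finset.Icc 1 N).erase m,
        b m * conj (b n) * (cexp (↑(Real.log m - Real.log n) * I * ↑(1 : ℝ)) - 1) /
          (((Real.log m - Real.log n) ^ 2 : ℝ) : ℂ)‖ ≤
      463 * ∑ n ∈ Finset.Icc 1 N, (n : ℝ) * ‖b n‖ ^ 2 := by
  classical
  set S := Finset.Icc 1 N with hS
  set B := ∑ n ∈ S, (n : ℝ) * ‖b n‖ ^ 2 with hB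
  set near : ℕ → ℕ → Prop := fun m n =>
    Nat.log 2 m ≤ Nat.log 2 n + 1 ∧ Nat.log 2 n ≤ Nat.log 2 m + 1 with hnear
  -- abbreviations for the kernels
  set r : ℕ → ℕ → ℂ := fun m n =>
    (cexp (↑(Real.log m - Real.log n) * I * ↑(1 : ℝ)) - 1) /
      (((Real.log m - Real.log n) ^ 2 : ℝ) : ℂ) with hr
  set q : ℕ → ℕ → ℂ := fun m n => r m n - I / ((Real.log m - Real.log n : ℝ) : ℂ) with hq
  have hterm : ∀ m n, b m * conj (b n) * (cexp (↑(Real.log m - Real.log n) * I * ↑(1 : ℝ)) - 1) /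
      (((Real.log m - Real.log n) ^ 2 : ℝ) : ℂ) = b m * conj (b n) * r m n := by
    intro m n; simp only [hr]; ring
  -- the decomposition `R = Far + (I T + Q)`
  have hsplit : ∀ m ∈ S, ∑ n ∈ S.erase m, b m * conj (b n) *
      (cexp (↑(Real.log m - Real.log n) * I * ↑(1 : ℝ)) - 1) /
        (((Real.log m - Real.log n) ^ 2 : ℝ) : ℂ) =
      ∑ n ∈ (S.erase m).filter (fun n => ¬near m n), b m * conj (b n) *
        (cexp (↑(Real.log m - Real.log n) * I * ↑(1 : ℝ)) - 1) /
          (((Real.log m - Real.log n) ^ 2 : ℝ) : ℂ) +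
      (I * ∑ n ∈ (S.erase m).filter (fun n => near m n),
          b m * conj (b n) / ((Real.log m - Real.log n : ℝ) : ℂ) +
        ∑ n ∈ (S.erase m).filter (fun n => near m n), b m * conj (b n) * q m n) := by
    intro m _
    rw [← Finset.sum_filter_add_sum_filter_not (S.erase m) (fun n => near m n), add_comm]
    congr 1
    rw [Finset.mul_sum, ← Finset.sum_add_distrib]
    refine Finset.sum_congr rfl fun n _ => ?_
    rw [hterm]
    simp only [hq]
    ring
  rw [Finset.sum_congr rfl hsplit, Finset.sum_add_distrib, Finset.sum_add_distrib,
    ← Finset.mul_sum]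
  have hFar := norm_farPart_le N b
  have hT := norm_nearForm_le N b
  have hQ : ‖∑ m ∈ S, ∑ n ∈ (S.erase m).filter (fun n => near m n),
      b m * conj (b n) * q m n‖ ≤ 12 * B := by
    calc ‖∑ m ∈ S, ∑ n ∈ (S.erase m).filter (fun n => near m n), b m * conj (b n) * q m n‖
        ≤ ∑ m ∈ S, ∑ n ∈ (S.erase m).filter (fun n => near m n), 3 * (‖b m‖ * ‖b n‖) := by
          refine (norm_sum_le _ _).trans (Finset.sum_le_sum fun m hm => ?_)
          refine (norm_sum_le _ _).trans (Finset.sum_le_sum fun n hn => ?_)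
          rw [Finset.mem_filter, Finset.mem_erase] at hn
          have hm1 : (0 : ℝ) < m := by exact_mod_cast (Finset.mem_Icc.mp hm).1
          have hn1 : (0 : ℝ) < n := by exact_mod_cast (Finset.mem_Icc.mp hn.1.2).1
          have hc : Real.log m - Real.log n ≠ 0 := by
            rw [sub_ne_zero]
            intro h
            have := Real.log_injOn_pos (Set.mem_Ioi.mpr hm1) (Set.mem_Ioi.mpr hn1) h
            exact hn.1.1 (by exact_mod_cast this.symm)
          rw [norm_mul, norm_mul, Complex.norm_conj]
          have hq3 : ‖q m n‖ ≤ 3 := norm_near_kernel_sub_le hc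
          have : 0 ≤ ‖b m‖ * ‖b n‖ := by positivity
          nlinarith
      _ = 3 * ∑ m ∈ S, ∑ n ∈ (S.erase m).filter (fun n => near m n), ‖b m‖ * ‖b n‖ := by
          rw [Finset.mul_sum]
          exact Finset.sum_congr rfl fun m _ => by rw [Finset.mul_sum]
      _ ≤ 3 * (4 * B) := by
          gcongr
          exact sum_near_norm_mul_le N b
      _ = 12 * B := by ring
  calc _ ≤ ‖∑ m ∈ S, ∑ n ∈ (S.erase m).filter (fun n => ¬near m n), b m * conj (b n) *
          (cexp (↑(Real.log m - Real.log n) * I * ↑(1 : ℝ)) - 1) /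
            (((Real.log m - Real.log n) ^ 2 : ℝ) : ℂ)‖ +
        ‖I * ∑ m ∈ S, ∑ n ∈ (S.erase m).filter (fun n => near m n),
            b m * conj (b n) / ((Real.log m - Real.log n : ℝ) : ℂ) +
          ∑ m ∈ S, ∑ n ∈ (S.erase m).filter (fun n => near m n),
            b m * conj (b n) * q m n‖ := norm_add_le _ _
    _ ≤ 67 * B + (384 * B + 12 * B) := by
        refine add_le_add hFar ((norm_add_le _ _).trans (add_le_add ?_ hQ))
        rw [norm_mul, Complex.norm_I, one_mul]
        exact hT
    _ = 463 * B := by ring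

end HilbertIneqLog

open HilbertIneqLog in
/-- **The weighted Hilbert inequality for `log n`** (Ivić 1985, (5.5):
"`∑_{m ≠ n ≤ N} a_m ā_n / (log m - log n) ≪ ∑_{n ≤ N} n |a_n|²`", the case `λ_n = log n`,
`δ_n ≍ 1/n` of the Montgomery–Vaughan weighted Hilbert inequality), PROVED with the explicit
constant `464`:
`|∑_{m ≤ N} ∑_{n ≤ N, n ≠ m} a_m ā_n/(log m - log n)| ≤ 464 ∑_{n ≤ N} n |a_n|²`.
[cite: Ivic1985, (5.5)] -/
theorem norm_hilbertForm_log_le (N : ℕ) (a : ℕ → ℂ) :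
    ‖∑ m ∈ Finset.Icc 1 N, ∑ n ∈ (Finset.Icc 1 N).erase m,
        a m * conj (a n) / ((Real.log m - Real.log n : ℝ) : ℂ)‖ ≤
      464 * ∑ n ∈ Finset.Icc 1 N, (n : ℝ) * ‖a n‖ ^ 2 := by
  have hu := log_injOn_Icc N
  have h1 := HilbertIneq.im_hilbertForm_le (Finset.Icc 1 N) (fun n : ℕ => Real.log n) hu a
    zero_le_one
  have h2 := HilbertIneq.im_hilbertForm_le (Finset.Icc 1 N) (fun n : ℕ => Real.log n) hu
    (fun n => conj (a n)) zero_le_one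
  have hR1 := norm_logRemainder_le N a
  have hR2 := norm_logRemainder_le N (fun n => conj (a n))
  have k1 := (neg_le_abs _).trans ((Complex.abs_re_le_norm _).trans hR1)
  have k2 := (neg_le_abs _).trans ((Complex.abs_re_le_norm _).trans hR2)
  simp only [Complex.norm_conj] at h2 k2
  rw [HilbertIneq.hilbertForm_conj_conj, Complex.neg_im] at h2
  have hSB : ∑ n ∈ Finset.Icc 1 N, ‖a n‖ ^ 2 ≤ ∑ n ∈ Finset.Icc 1 N, (n : ℝ) * ‖a n‖ ^ 2 := by
    refine Finset.sum_le_sum fun n hn => ?_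
    have : (1 : ℝ) ≤ n := by exact_mod_cast (Finset.mem_Icc.mp hn).1
    nlinarith [sq_nonneg ‖a n‖]
  have hB0 : 0 ≤ ∑ n ∈ Finset.Icc 1 N, (n : ℝ) * ‖a n‖ ^ 2 :=
    Finset.sum_nonneg fun n _ => by positivity
  rw [HilbertIneq.norm_hilbertForm_eq_abs_im, abs_le]
  constructor
  · linarith
  · linarith

end Literature.NumberTheory.LFunctions
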